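import Mathlib
import Summits.NavierStokesRegularity.NavierStokesRegularity.Theorems.PlaneEnergyCeilingPlanarEnergyAPrioriHeatKernel1D
import Summits.NavierStokesRegularity.NavierStokesRegularity.Theorems.PlaneEnergyCeilingPlanarEnergyAPrioriWeightedIdentity
import Summits.NavierStokesRegularity.NavierStokesRegularity.Theorems.PlaneEnergyCeilingPlanarEnergyAPrioriFluxLedger

/-!
# Route PlaneEnergyCeiling · crux `PlanarEnergyAPriori` — the mild slab law, space side

Helper file for the crux item stmt-NavierStokesRegularity-16855 (`PlanarEnergyAPriori`, route
`PlaneEnergyCeiling`), toward the registered stub `stub_slabLawMild` of the line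
`Cruxes/PlanarEnergyAPriori/Lines/birth.lean` (THE SLAB ENERGY LAW IN MILD FORM). At a fixed time,
test the local energy identity with the shifted backward kernel `W(x) = G_σ(x₂ − c₀)`
(`σ = ν(t − s)`), whose time derivative along the solution is `W' = −ν G_σ''(x₂ − c₀)`:

* the weighted identity (`weightedEnergyIdentity_of_decay`, landed) gives
  `∫ W·2⟪acc,u⟫ = ν∫G''|u|² − 2ν∫GΣ‖∂ⱼu‖² + 2∫G'(|u|²/2+p)u₂`; the `ν∫G''|u|²` term CANCELS
  against `∫ W'|u|²`, the dissipation is signed away, and what is left is the flux term;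
* Fubini through the slab chart turns the flux term into `2∫ G_σ'(c − c₀) F(c) dc` with the planar
  flux `F(c) = ∫_{x₂=c} (|u|²/2+p)u₂`, and `∫ G_σ' = 0` lets one subtract `F(c₁)`;
* in `ℝ≥0∞`: `ofReal (∫ W'|u|² + W·2⟪acc,u⟫) ≤ 2 (√(πσ))⁻¹ · sup_{a,b} ‖F(a) − F(b)‖ₑ`
  (`slabLaw_sliceBound_ennreal`), by the sharp `L¹` norm of `G_σ'` (landed
  `lintegral_enorm_deriv_heatKernel_real`).

Folklore (Caffarelli–Kohn–Nirenberg 1982 §2 tested with a caloric weight of one coordinate).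
-/

noncomputable section

-- single-conjunct summit: `Summit.<Summit>.<Problem>` repeats the name by the D-0017 layout
set_option linter.dupNamespace false

namespace Summit.NavierStokesRegularity.NavierStokesRegularity.Theorems.PlanarEnergyAPriori

open MeasureTheory Set Filter Topology Function WithLp Real
open scoped ENNReal RealInnerProductSpace Laplacian
open Literature.Analysis.FluidPDE Literature.Analysis.UnboundedOperators
open Summit.NavierStokesRegularity.NavierStokesRegularity.Theorems.PlaneEnergyCeilingSlabEnergyIdentity
open Summit.NavierStokesRegularity.NavierStokesRegularity.Theorems.PlanarEnergyAPriori.SlabLaw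

/-! ### The shifted kernel `z ↦ G_σ(z − c₀)` as a weight of the height -/

/-- `∂_z G_σ(z − c₀) = −((z − c₀)/(2σ)) G_σ(z − c₀)`. -/
theorem hasDerivAt_heatKernel_shift (σ c₀ z : ℝ) :
    HasDerivAt (fun z => heatKernel σ (z - c₀)) (-((z - c₀) / (2 * σ)) * heatKernel σ (z - c₀)) z := by
  have h := (hasDerivAt_heatKernel_real σ (z - c₀)).comp z ((hasDerivAt_id z).sub_const c₀)
  simpa [Function.comp_def] using h

/-- The derivative of the shifted kernel as a function. -/
theorem deriv_heatKernel_shift (σ c₀ : ℝ) :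
    deriv (fun z => heatKernel σ (z - c₀)) = fun z => -((z - c₀) / (2 * σ)) * heatKernel σ (z - c₀) :=
  funext fun z => (hasDerivAt_heatKernel_shift σ c₀ z).deriv

/-- `∂²_z G_σ(z − c₀) = ((z − c₀)²/(4σ²) − 1/(2σ)) G_σ(z − c₀)`. -/
theorem hasDerivAt_deriv_heatKernel_shift (σ c₀ z : ℝ) :
    HasDerivAt (fun z => -((z - c₀) / (2 * σ)) * heatKernel σ (z - c₀))
      (((z - c₀) ^ 2 / (4 * σ ^ 2) - 1 / (2 * σ)) * heatKernel σ (z - c₀)) z := by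
  have h := (hasDerivAt_deriv_heatKernel_real σ (z - c₀)).comp z ((hasDerivAt_id z).sub_const c₀)
  simpa [Function.comp_def] using h

/-- The second derivative of the shifted kernel as a function. -/
theorem deriv2_heatKernel_shift (σ c₀ : ℝ) :
    deriv (deriv fun z => heatKernel σ (z - c₀)) =
      fun z => ((z - c₀) ^ 2 / (4 * σ ^ 2) - 1 / (2 * σ)) * heatKernel σ (z - c₀) := by
  rw [deriv_heatKernel_shift]
  exact funext fun z => (hasDerivAt_deriv_heatKernel_shift σ c₀ z).deriv

/-- The 1-D kernel is smooth in space (explicit Gaussian). -/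
theorem contDiff_heatKernel_real (σ : ℝ) {n : WithTop ℕ∞} : ContDiff ℝ n (heatKernel (E := ℝ) σ) := by
  have : heatKernel (E := ℝ) σ = fun z => (4 * π * σ) ^ (-(1 : ℝ) / 2) * Real.exp (-z ^ 2 / (4 * σ)) :=
    funext (heatKernel_real_eq σ)
  rw [this]
  exact contDiff_const.mul (Real.contDiff_exp.comp (((contDiff_id.pow 2).neg).div_const _))

/-- The shifted kernel is smooth. -/
theorem contDiff_heatKernel_shift (σ c₀ : ℝ) {n : WithTop ℕ∞} :
    ContDiff ℝ n (fun z => heatKernel σ (z - c₀)) :=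
  (contDiff_heatKernel_real σ).comp (contDiff_id.sub contDiff_const)

/-- One constant bounding the shifted kernel and its first two derivatives (`0 < σ`). -/
theorem heatKernel_shift_bounds {σ : ℝ} (hσ : 0 < σ) (c₀ : ℝ) :
    ∃ K : ℝ, (∀ z, |heatKernel σ (z - c₀)| ≤ K) ∧
      (∀ z, |-((z - c₀) / (2 * σ)) * heatKernel σ (z - c₀)| ≤ K) ∧
      ∀ z, |((z - c₀) ^ 2 / (4 * σ ^ 2) - 1 / (2 * σ)) * heatKernel σ (z - c₀)| ≤ K := by
  set A : ℝ := (4 * π * σ) ^ (-(1 : ℝ) / 2) with hA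
  have hA0 : 0 ≤ A := by positivity
  have hB : 0 ≤ A * ((1 + 4 * σ) / (4 * σ)) := by positivity
  have hB' : 0 ≤ A * (3 / (2 * σ)) := by positivity
  refine ⟨A + A * ((1 + 4 * σ) / (4 * σ)) + A * (3 / (2 * σ)), fun z => ?_, fun z => ?_, fun z => ?_⟩
  · rw [abs_of_nonneg (heatKernel_pos hσ _).le]
    have h := heatKernel_real_le hσ (z - c₀)
    linarith
  · have h := abs_deriv_heatKernel_real_le hσ (z - c₀)
    rw [← hA] at h
    linarith
  · have h := abs_deriv2_heatKernel_real_le hσ (z - c₀)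
    rw [← hA] at h
    linarith

/-! ### Fubini through the slab chart on the whole space -/

/-- **Fubini through the slab chart**: `∫_{ℝ³} φ = ∫_c ∫_y φ(y₀,y₁,c)` for integrable `φ`. -/
theorem integral_eq_integral_height_plane {F : Type*} [NormedAddCommGroup F] [NormedSpace ℝ F]
    {φ : EuclideanSpace ℝ (Fin 3) → F} (hφ : Integrable φ) :
    ∫ x, φ x = ∫ c : ℝ, ∫ y : EuclideanSpace ℝ (Fin 2), φ (toLp 2 ![y 0, y 1, c]) := by
  obtain ⟨e, he, heq⟩ := exists_slabChart
  have hint : Integrable (fun z : ℝ × EuclideanSpace ℝ (Fin 2) => φ (e z)) (volume.prod volume) :=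
    (he.integrable_comp_emb e.measurableEmbedding).2 hφ
  rw [← he.integral_comp e.measurableEmbedding, Measure.volume_eq_prod, integral_prod _ hint]
  simp only [heq]

/-- The height marginal `c ↦ ∫_y φ(y₀,y₁,c)` of an integrable `φ` is integrable. -/
theorem integrable_integral_plane {F : Type*} [NormedAddCommGroup F] [NormedSpace ℝ F]
    {φ : EuclideanSpace ℝ (Fin 3) → F} (hφ : Integrable φ) :
    Integrable fun c : ℝ => ∫ y : EuclideanSpace ℝ (Fin 2), φ (toLp 2 ![y 0, y 1, c]) := by
  obtain ⟨e, he, heq⟩ := exists_slabChart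
  have hint : Integrable (fun z : ℝ × EuclideanSpace ℝ (Fin 2) => φ (e z)) (volume.prod volume) :=
    (he.integrable_comp_emb e.measurableEmbedding).2 hφ
  simpa only [heq] using hint.integral_prod_left

/-- **Weighted Fubini**: `∫ w(x₂) f(x) dx = ∫_c w(c) (∫_y f(y₀,y₁,c)) dc` for integrable `f` and a
bounded continuous weight `w` of the height. -/
theorem integral_weight_mul_eq_integral_mul_integral_plane {f : EuclideanSpace ℝ (Fin 3) → ℝ}
    (hf : Integrable f) {w : ℝ → ℝ} (hw : Continuous w) {K : ℝ} (hK : ∀ z, |w z| ≤ K) :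
    ∫ x, w (x 2) * f x = ∫ c : ℝ, w c * ∫ y : EuclideanSpace ℝ (Fin 2), f (toLp 2 ![y 0, y 1, c]) := by
  rw [integral_eq_integral_height_plane (integrable_weight_mul hf hw hK)]
  refine integral_congr_ae (ae_of_all _ fun c => ?_)
  simp only [Matrix.cons_val_two, Matrix.tail_cons, Matrix.head_cons]
  exact integral_const_mul _ _

/-- The weighted height marginal `c ↦ w(c) ∫_y f(y₀,y₁,c)` is integrable. -/
theorem integrable_weight_mul_integral_plane {f : EuclideanSpace ℝ (Fin 3) → ℝ}
    (hf : Integrable f) {w : ℝ → ℝ} (hw : Continuous w) {K : ℝ} (hK : ∀ z, |w z| ≤ K) :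
    Integrable fun c : ℝ => w c * ∫ y : EuclideanSpace ℝ (Fin 2), f (toLp 2 ![y 0, y 1, c]) := by
  have h := integrable_integral_plane (integrable_weight_mul hf hw hK)
  refine h.congr (ae_of_all _ fun c => ?_)
  simp only [Matrix.cons_val_two, Matrix.tail_cons, Matrix.head_cons]
  exact integral_const_mul _ _

/-! ### The slice bound -/

variable {ν σ : ℝ} {u : EuclideanSpace ℝ (Fin 3) → EuclideanSpace ℝ (Fin 3)} {p : EuclideanSpace ℝ (Fin 3) → ℝ} {C : ℝ}

/-- **The flux term through the kernel**: with `F(c) = ∫_{x₂=c}(|u|²/2+p)u₂`,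
`∫ G_σ'(x₂−c₀)(|u|²/2+p)u₂ dx = ∫ G_σ'(c−c₀)(F(c) − F(c₁)) dc` (Fubini and `∫ G_σ' = 0`). -/
theorem integral_kernelDeriv_mul_bernoulli_eq (hσ : 0 < σ) (c₀ c₁ : ℝ)
    (hu : ContDiff ℝ 1 u) (hp : ContDiff ℝ 1 p)
    (h0 : ∀ x, ‖u x‖ ≤ C * (1 + ‖x‖) ^ (-(3 : ℝ))) (k0 : ∀ x, ‖p x‖ ≤ C * (1 + ‖x‖) ^ (-(2 : ℝ))) :
    ∫ x, (-((x 2 - c₀) / (2 * σ)) * heatKernel σ (x 2 - c₀)) * ((‖u x‖ ^ 2 / 2 + p x) * u x 2) =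
      ∫ c : ℝ, (-((c - c₀) / (2 * σ)) * heatKernel σ (c - c₀)) *
        ((∫ y : EuclideanSpace ℝ (Fin 2), (‖u (toLp 2 ![y 0, y 1, c])‖ ^ 2 / 2 + p (toLp 2 ![y 0, y 1, c])) *
            u (toLp 2 ![y 0, y 1, c]) 2) -
          ∫ y : EuclideanSpace ℝ (Fin 2), (‖u (toLp 2 ![y 0, y 1, c₁])‖ ^ 2 / 2 + p (toLp 2 ![y 0, y 1, c₁])) *
            u (toLp 2 ![y 0, y 1, c₁]) 2) := by
  obtain ⟨K, -, hB1, -⟩ := heatKernel_shift_bounds hσ c₀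
  have hw : Continuous fun z : ℝ => -((z - c₀) / (2 * σ)) * heatKernel σ (z - c₀) :=
    ((contDiff_heatKernel_shift σ c₀ (n := 1)).continuous_deriv le_rfl).congr
      fun z => by rw [deriv_heatKernel_shift]
  have hf : Integrable fun x => (‖u x‖ ^ 2 / 2 + p x) * u x 2 := integrable_bernoulli_mul' hu hp h0 k0 2
  rw [integral_weight_mul_eq_integral_mul_integral_plane hf hw hB1]
  -- subtract the constant `F(c₁)`: `∫ G_σ'(c − c₀) dc = 0`
  have hI1 := integrable_weight_mul_integral_plane hf hw hB1
  have hint0 : ∫ c : ℝ, -((c - c₀) / (2 * σ)) * heatKernel σ (c - c₀) = 0 := by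
    rw [integral_sub_right_eq_self (fun z => -(z / (2 * σ)) * heatKernel σ z) c₀]
    exact integral_deriv_heatKernel_real hσ
  have hI2 : Integrable fun c : ℝ => (-((c - c₀) / (2 * σ)) * heatKernel σ (c - c₀)) *
      ∫ y : EuclideanSpace ℝ (Fin 2), (‖u (toLp 2 ![y 0, y 1, c₁])‖ ^ 2 / 2 + p (toLp 2 ![y 0, y 1, c₁])) *
        u (toLp 2 ![y 0, y 1, c₁]) 2 := by
    have hi : Integrable fun c : ℝ => -((c - c₀) / (2 * σ)) * heatKernel σ (c - c₀) := by
      have := (integrable_deriv_heatKernel_real hσ).comp_sub_right c₀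
      simpa using this
    exact hi.mul_const _
  simp_rw [mul_sub]
  rw [integral_sub hI1 hI2, integral_mul_const, hint0, zero_mul, sub_zero]

/-- **THE SLICE BOUND.** For a `C²` divergence-free `u` and a `C¹` scalar `p` with order-(3,2)
decay, a continuous tendency field `acc = νΔu − (u·∇)u − ∇p` (`ν ≥ 0`), `σ > 0` and `c₀, c₁ ∈ ℝ`:
with the caloric weight `W = G_σ(x₂ − c₀)` and `W' = −νG_σ''(x₂ − c₀)`,
`∫ (W'|u|² + W·2⟪acc,u⟫) ≤ 2∫ G_σ'(c − c₀)(F(c) − F(c₁)) dc` — the viscous terms cancel / are signed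
away by the weighted energy identity. [folklore] -/
theorem slabLaw_sliceBound (hν : 0 ≤ ν) (hσ : 0 < σ) (c₀ c₁ : ℝ)
    (hu : ContDiff ℝ 2 u) (hp : ContDiff ℝ 1 p) (hdiv : VectorCalculus.IsDivFree u)
    (h0 : ∀ x, ‖u x‖ ≤ C * (1 + ‖x‖) ^ (-(3 : ℝ))) (h1 : ∀ x, ‖fderiv ℝ u x‖ ≤ C * (1 + ‖x‖) ^ (-(3 : ℝ)))
    (h2 : ∀ x, ‖iteratedFDeriv ℝ 2 u x‖ ≤ C * (1 + ‖x‖) ^ (-(3 : ℝ)))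
    (k0 : ∀ x, ‖p x‖ ≤ C * (1 + ‖x‖) ^ (-(2 : ℝ))) (k1 : ∀ x, ‖fderiv ℝ p x‖ ≤ C * (1 + ‖x‖) ^ (-(2 : ℝ)))
    (hacc : Continuous fun x => ν • Δ u x - convect u u x - gradient p x) :
    ∫ x, (-ν * (((x 2 - c₀) ^ 2 / (4 * σ ^ 2) - 1 / (2 * σ)) * heatKernel σ (x 2 - c₀)) * ‖u x‖ ^ 2 +
        heatKernel σ (x 2 - c₀) * (2 * ⟪ν • Δ u x - convect u u x - gradient p x, u x⟫)) ≤
      2 * ∫ c : ℝ, (-((c - c₀) / (2 * σ)) * heatKernel σ (c - c₀)) *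
        ((∫ y : EuclideanSpace ℝ (Fin 2), (‖u (toLp 2 ![y 0, y 1, c])‖ ^ 2 / 2 + p (toLp 2 ![y 0, y 1, c])) *
            u (toLp 2 ![y 0, y 1, c]) 2) -
          ∫ y : EuclideanSpace ℝ (Fin 2), (‖u (toLp 2 ![y 0, y 1, c₁])‖ ^ 2 / 2 + p (toLp 2 ![y 0, y 1, c₁])) *
            u (toLp 2 ![y 0, y 1, c₁]) 2) := by
  have hC : 0 ≤ C := nonneg_of_norm_le_rpow h0
  obtain ⟨K, hB0, hB1, hB2⟩ := heatKernel_shift_bounds hσ c₀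
  have hg : ContDiff ℝ 2 (fun z => heatKernel σ (z - c₀)) := contDiff_heatKernel_shift σ c₀
  have hg'K : ∀ z, |deriv (fun z => heatKernel σ (z - c₀)) z| ≤ K := by
    rw [deriv_heatKernel_shift]; exact hB1
  have hg''K : ∀ z, |deriv (deriv fun z => heatKernel σ (z - c₀)) z| ≤ K := by
    rw [deriv2_heatKernel_shift]; exact hB2
  -- the weighted energy identity with the caloric weight
  have hWI := weightedEnergyIdentity_of_decay ν hu hp hdiv h0 h1 h2 k0 k1 hg hB0 hg'K hg''K
  rw [deriv2_heatKernel_shift, deriv_heatKernel_shift] at hWI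
  beta_reduce at hWI
  -- continuity of the explicit weights
  have hcG : Continuous fun z : ℝ => heatKernel σ (z - c₀) := (contDiff_heatKernel_shift σ c₀ (n := 0)).continuous
  have hcG'' : Continuous fun z : ℝ => ((z - c₀) ^ 2 / (4 * σ ^ 2) - 1 / (2 * σ)) * heatKernel σ (z - c₀) := by
    fun_prop
  -- integrability of the two parts of the density
  have hIsq : Integrable fun x => ‖u x‖ ^ 2 := integrable_norm_sq hu.continuous h0
  have hIX : Integrable fun x : EuclideanSpace ℝ (Fin 3) =>
      (((x 2 - c₀) ^ 2 / (4 * σ ^ 2) - 1 / (2 * σ)) * heatKernel σ (x 2 - c₀)) * ‖u x‖ ^ 2 :=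
    integrable_weight_mul hIsq hcG'' hB2
  have hIW' : Integrable fun x : EuclideanSpace ℝ (Fin 3) =>
      (-ν * (((x 2 - c₀) ^ 2 / (4 * σ ^ 2) - 1 / (2 * σ)) * heatKernel σ (x 2 - c₀))) * ‖u x‖ ^ 2 := by
    have := hIX.const_mul (-ν)
    refine this.congr (ae_of_all _ fun x => ?_)
    dsimp only
    ring
  have k1' : ∀ x, ‖gradient p x‖ ≤ C * (1 + ‖x‖) ^ (-(2 : ℝ)) := fun x => by
    rw [← norm_fderiv_eq_norm_gradient]; exact k1 x
  have hr : (Module.finrank ℝ (EuclideanSpace ℝ (Fin 3)) : ℝ) < 5 := by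
    rw [finrank_euclideanSpace, Fintype.card_fin]; norm_num
  have hIacc : Integrable fun x : EuclideanSpace ℝ (Fin 3) =>
      heatKernel σ (x 2 - c₀) * (2 * ⟪ν • Δ u x - convect u u x - gradient p x, u x⟫) := by
    refine Integrable.mono' ((integrable_one_add_norm hr).const_mul (2 * K * C * (3 * ν * C + C ^ 2 + C)))
      ((continuous_weight hcG).mul (continuous_const.mul (hacc.inner hu.continuous))).aestronglyMeasurable
      (ae_of_all _ fun x => ?_)
    exact norm_weight_mul_two_inner_acc_le hν hC (h0 x) (h1 x) (h2 x) (k1' x) hB0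
  -- split, cancel, sign away the dissipation
  rw [integral_add hIW' hIacc]
  have hW' : ∫ x : EuclideanSpace ℝ (Fin 3),
      (-ν * (((x 2 - c₀) ^ 2 / (4 * σ ^ 2) - 1 / (2 * σ)) * heatKernel σ (x 2 - c₀))) * ‖u x‖ ^ 2 =
      -ν * ∫ x : EuclideanSpace ℝ (Fin 3),
        (((x 2 - c₀) ^ 2 / (4 * σ ^ 2) - 1 / (2 * σ)) * heatKernel σ (x 2 - c₀)) * ‖u x‖ ^ 2 := by
    rw [← integral_const_mul]
    refine integral_congr_ae (ae_of_all _ fun x => ?_)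
    dsimp only; ring
  have hcomm : ∫ x : EuclideanSpace ℝ (Fin 3),
      heatKernel σ (x 2 - c₀) * (2 * ⟪ν • Δ u x - convect u u x - gradient p x, u x⟫) =
      ∫ x : EuclideanSpace ℝ (Fin 3),
        heatKernel σ (x 2 - c₀) * (2 * ⟪u x, ν • Δ u x - convect u u x - gradient p x⟫) :=
    integral_congr_ae (ae_of_all _ fun x => by dsimp only; rw [real_inner_comm])
  have hD : 0 ≤ ∫ x : EuclideanSpace ℝ (Fin 3),
      heatKernel σ (x 2 - c₀) * ∑ j : Fin 3, ‖fderiv ℝ u x (EuclideanSpace.single j 1)‖ ^ 2 :=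
    integral_nonneg fun x => mul_nonneg (heatKernel_pos hσ _).le (Finset.sum_nonneg fun j _ => sq_nonneg _)
  rw [hW', hcomm, hWI, integral_kernelDeriv_mul_bernoulli_eq hσ c₀ c₁ (hu.of_le one_le_two) hp h0 k0]
  nlinarith [mul_nonneg hν hD]

/-- **The slice bound in `ℝ≥0∞`.** Same setting; with `F(c) = ∫_{x₂=c}(|u|²/2+p)u₂`:
`ofReal (∫ (W'|u|² + W·2⟪acc,u⟫)) ≤ 2 · ofReal((√(πσ))⁻¹) · sup_{a,b} ‖F(a) − F(b)‖ₑ`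
(the sharp `L¹` norm `∫|G_σ'| = (√(πσ))⁻¹`). [folklore] -/
theorem slabLaw_sliceBound_ennreal (hν : 0 ≤ ν) (hσ : 0 < σ) (c₀ : ℝ)
    (hu : ContDiff ℝ 2 u) (hp : ContDiff ℝ 1 p) (hdiv : VectorCalculus.IsDivFree u)
    (h0 : ∀ x, ‖u x‖ ≤ C * (1 + ‖x‖) ^ (-(3 : ℝ))) (h1 : ∀ x, ‖fderiv ℝ u x‖ ≤ C * (1 + ‖x‖) ^ (-(3 : ℝ)))
    (h2 : ∀ x, ‖iteratedFDeriv ℝ 2 u x‖ ≤ C * (1 + ‖x‖) ^ (-(3 : ℝ)))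
    (k0 : ∀ x, ‖p x‖ ≤ C * (1 + ‖x‖) ^ (-(2 : ℝ))) (k1 : ∀ x, ‖fderiv ℝ p x‖ ≤ C * (1 + ‖x‖) ^ (-(2 : ℝ)))
    (hacc : Continuous fun x => ν • Δ u x - convect u u x - gradient p x) :
    ENNReal.ofReal (∫ x, (-ν * (((x 2 - c₀) ^ 2 / (4 * σ ^ 2) - 1 / (2 * σ)) * heatKernel σ (x 2 - c₀)) * ‖u x‖ ^ 2 +
        heatKernel σ (x 2 - c₀) * (2 * ⟪ν • Δ u x - convect u u x - gradient p x, u x⟫))) ≤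
      2 * (ENNReal.ofReal ((Real.sqrt (π * σ))⁻¹) *
        ⨆ (a : ℝ) (b : ℝ), ‖(∫ y : EuclideanSpace ℝ (Fin 2), (‖u (toLp 2 ![y 0, y 1, a])‖ ^ 2 / 2 + p (toLp 2 ![y 0, y 1, a])) *
              u (toLp 2 ![y 0, y 1, a]) 2) -
            ∫ y : EuclideanSpace ℝ (Fin 2), (‖u (toLp 2 ![y 0, y 1, b])‖ ^ 2 / 2 + p (toLp 2 ![y 0, y 1, b])) *
              u (toLp 2 ![y 0, y 1, b]) 2‖ₑ) := by
  -- names for the planar flux and its oscillation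
  obtain ⟨F, hF⟩ : ∃ F : ℝ → ℝ, F = fun c => ∫ y : EuclideanSpace ℝ (Fin 2),
      (‖u (toLp 2 ![y 0, y 1, c])‖ ^ 2 / 2 + p (toLp 2 ![y 0, y 1, c])) * u (toLp 2 ![y 0, y 1, c]) 2 := ⟨_, rfl⟩
  obtain ⟨S, hS⟩ : ∃ S : ℝ≥0∞, S = ⨆ (a : ℝ) (b : ℝ), ‖F a - F b‖ₑ := ⟨_, rfl⟩
  have hle := slabLaw_sliceBound hν hσ c₀ 0 hu hp hdiv h0 h1 h2 k0 k1 hacc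
  have hF' : ∀ c, (∫ y : EuclideanSpace ℝ (Fin 2),
      (‖u (toLp 2 ![y 0, y 1, c])‖ ^ 2 / 2 + p (toLp 2 ![y 0, y 1, c])) * u (toLp 2 ![y 0, y 1, c]) 2) = F c :=
    fun c => by rw [hF]
  simp_rw [hF'] at hle ⊢
  rw [← hS]
  -- `ofReal (2∫ G'(F − F 0)) ≤ 2 ∫⁻ ‖G'‖ₑ ‖F − F 0‖ₑ ≤ 2 (∫⁻‖G'‖ₑ) S`
  have hmeas : Measurable fun c : ℝ => ‖-((c - c₀) / (2 * σ)) * heatKernel σ (c - c₀)‖ₑ := by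
    have hw : Continuous fun z : ℝ => -((z - c₀) / (2 * σ)) * heatKernel σ (z - c₀) := by
      have hcG : Continuous fun z : ℝ => heatKernel σ (z - c₀) := (contDiff_heatKernel_shift σ c₀ (n := 0)).continuous
      fun_prop
    exact hw.measurable.enorm
  have hker : ∫⁻ c : ℝ, ‖-((c - c₀) / (2 * σ)) * heatKernel σ (c - c₀)‖ₑ = ENNReal.ofReal ((Real.sqrt (π * σ))⁻¹) := by
    rw [lintegral_sub_right_eq_self (fun z : ℝ => ‖-(z / (2 * σ)) * heatKernel σ z‖ₑ) c₀]
    exact lintegral_enorm_deriv_heatKernel_real hσ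
  calc ENNReal.ofReal _ ≤ ENNReal.ofReal (2 * ∫ c : ℝ, (-((c - c₀) / (2 * σ)) * heatKernel σ (c - c₀)) * (F c - F 0)) :=
        ENNReal.ofReal_le_ofReal hle
    _ ≤ 2 * ‖∫ c : ℝ, (-((c - c₀) / (2 * σ)) * heatKernel σ (c - c₀)) * (F c - F 0)‖ₑ := by
        rw [ENNReal.ofReal_mul zero_le_two, ENNReal.ofReal_ofNat]
        gcongr
        rw [Real.enorm_eq_ofReal_abs]
        exact ENNReal.ofReal_le_ofReal (le_abs_self _)
    _ ≤ 2 * ∫⁻ c : ℝ, ‖(-((c - c₀) / (2 * σ)) * heatKernel σ (c - c₀)) * (F c - F 0)‖ₑ := by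
        gcongr; exact enorm_integral_le_lintegral_enorm _
    _ ≤ 2 * ∫⁻ c : ℝ, ‖-((c - c₀) / (2 * σ)) * heatKernel σ (c - c₀)‖ₑ * S := by
        gcongr with c
        rw [enorm_mul]
        gcongr
        rw [hS]
        exact le_iSup₂ (f := fun a b => ‖F a - F b‖ₑ) c 0
    _ = 2 * (ENNReal.ofReal ((Real.sqrt (π * σ))⁻¹) * S) := by
        rw [lintegral_mul_const _ hmeas, hker]

/-- **The slice bound of the mild slab law, registered closed form** (sub-goal
`slabLaw_sliceBound_closedForm` of stmt-NavierStokesRegularity-16855, toward `stub_slabLawMild`).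
[folklore] -/
theorem slabLaw_sliceBound_closedForm : ∀ (ν σ : ℝ), 0 ≤ ν → 0 < σ → ∀ (u : EuclideanSpace ℝ (Fin 3) → EuclideanSpace ℝ (Fin 3)) (p : EuclideanSpace ℝ (Fin 3) → ℝ) (C : ℝ), ContDiff ℝ 2 u → ContDiff ℝ 1 p → Literature.Analysis.FluidPDE.VectorCalculus.IsDivFree u → (∀ x, ‖u x‖ ≤ C * (1 + ‖x‖) ^ (-(3 : ℝ))) → (∀ x, ‖fderiv ℝ u x‖ ≤ C * (1 + ‖x‖) ^ (-(3 : ℝ))) → (∀ x, ‖iteratedFDeriv ℝ 2 u x‖ ≤ C * (1 + ‖x‖) ^ (-(3 : ℝ))) → (∀ x, ‖p x‖ ≤ C * (1 + ‖x‖) ^ (-(2 : ℝ))) → (∀ x, ‖fderiv ℝ p x‖ ≤ C * (1 + ‖x‖) ^ (-(2 : ℝ))) → (Continuous fun x => ν • Laplacian.laplacian u x - Literature.Analysis.FluidPDE.convect u u x - gradient p x) → ∀ (c₀ : ℝ), ENNReal.ofReal (∫ x, (-ν * (((x 2 - c₀) ^ 2 / (4 * σ ^ 2) - 1 / (2 *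 σ)) * Literature.Analysis.UnboundedOperators.heatKernel σ (x 2 - c₀))) * ‖u x‖ ^ 2 + Literature.Analysis.UnboundedOperators.heatKernel σ (x 2 - c₀) * (2 * inner ℝ (ν • Laplacian.laplacian u x - Literature.Analysis.FluidPDE.convect u u x - gradient p x) (u x))) ≤ 2 * (ENNReal.ofReal ((Real.sqrt (Real.pi * σ))⁻¹) * ⨆ (a : ℝ) (b : ℝ), ‖(∫ y : EuclideanSpace ℝ (Fin 2), (‖u (WithLp.toLp 2 ![y 0, y 1, a])‖ ^ 2 / 2 + p (WithLp.toLp 2 ![y 0, y 1, a])) * u (WithLp.toLp 2 ![y 0, y 1, a]) 2) - ∫ y : EuclideanSpace ℝ (Fin 2), (‖u (WithLp.toLp 2 ![y 0, y 1, b])‖ ^ 2 / 2 + p (WithLp.toLp 2 ![y 0, y 1, b])) * u (WithLp.toLp 2 ![y 0, y 1, b]) 2‖ₑ) :=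
  fun _ _ hν hσ _ _ _ hu hp hdiv h0 h1 h2 k0 k1 hacc c₀ =>
    slabLaw_sliceBound_ennreal hν hσ c₀ hu hp hdiv h0 h1 h2 k0 k1 hacc

end Summit.NavierStokesRegularity.NavierStokesRegularity.Theorems.PlanarEnergyAPriori

end
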